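import Summits.QuantumFields.YangMills.Theses.F4SubCurvatureDoor
import Summits.QuantumFields.YangMills.Theorems.F4SubCurvatureDoorSubCurvatureKernelContinuousVersion
import Summits.QuantumFields.YangMills.Theorems.F4SubCurvatureDoorSubCurvatureKernelSoftKernelOfContinuous
import Mathlib
import HarnessLib

/-!
# Route `F4SubCurvatureDoor`, crux `SubCurvatureKernel` ⟨stmt-QuantumFields-23036⟩ — ★ THE SOFT HALF, UNCONDITIONALLY; and
# `SubCurvatureKernel` ⇐ the SUB-CURVATURE CLAUSE alone

Helper file (`--supports stmt-QuantumFields-23036 --as helper`; free-hands seat `ym-line-frs-p2` g18).  Definition-free, 0 sorry,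
standard axioms.  No item is closed; no summit, no crux and no mass gap is proved by this file.

WHAT.
* ★ `softHalf_of_offDiagLimitAlong` — under `MomentBounds6`, EVERY off-diagonal limit point `S₁` of an admissible leg scheme has a two-point
  kernel `K : ℝ⁴ → ℝ` satisfying ALL SIX SOFT CLAUSES of the crux `SubCurvatureKernel` verbatim: (1) continuous off `0`, (2) bounded off the
  unit ball, (3) `W(B₄)`-invariant, (4) pointwise reflection positive, (6) representing `S₁ 2` on `⁰𝒮₂`, (7) King-faithful — plus measurability,
  the sharp bound `|K u| ≤ A (1 + ‖u‖⁻¹)⁸` off `0`, and the representation on every off-diagonal Schwartz test function.  Composition of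
  ✓`continuousKernel_of_offDiagLimitAlong` (this seat, input (C)) with ✓`softKernel_clauses_of_continuous_kernel` (g17).
* ★ `subCurvatureKernel_of_subCurvatureClause` — hence the crux `F4SubCurvatureDoor.SubCurvatureKernel` FOLLOWS FROM ITS SUB-CURVATURE CLAUSE
  ALONE: if for every leg-scheme limit point and every kernel continuous off `0` representing its two-point function on compactly supported
  off-diagonal test functions `‖x‖⁸ K(x) → 0` at `0` (the owner's child `SubCurvatureClause`, HOME `g23/Sketch23036SplitV2.lean`, unfolded),
  then `SubCurvatureKernel` — the owner's glue `subCurvatureKernel_of_continuousKernel` with its first hypothesis DISCHARGED.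

HONEST LABEL: the soft half of an OPEN-PROBLEM crux is proved; the SUB-CURVATURE clause (asymptotic freedom of the continuum `tr F²` two-point
function, the Yang–Mills-specific UV input) is the crux and is untouched; ⟨23036⟩ is open; rung R2d still needs ⟨22566⟩ ⟨23036⟩ ⟨23037⟩; the
Yang–Mills mass gap is NOT proved; no summit is proved by a line.
-/

set_option autoImplicit false

noncomputable section

open scoped SchwartzMap BigOperators Topology
open MeasureTheory Filter Set
open Literature.MathematicalPhysics.QuantumFieldTheory Literature.MathematicalPhysics.QuantumLattice
open Literature.MathematicalPhysics.AQFT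
open Summit.QuantumFields.YangMills.Cruxes.OSLegsFromFemtoAndGap.DlrCollarTransfer (MomentBounds6)
open Summit.QuantumFields.YangMills.Cruxes.OSLegsAtWeakCouplingC.Sketch (IsSignedPerm)
open Summit.QuantumFields.YangMills.Cruxes.OSLegsAtWeakCouplingC.Y2Bridge (King.KingClass)
open Summit.QuantumFields.YangMills.Theorems.ROT (IsLegScheme OffDiagLimitAlong)
open Summit.QuantumFields.YangMills.Theorems.NPointIsotropy.Negative (E4)
open Summit.QuantumFields.YangMills.Theorems.F4SubCurvatureDoorSubCurvatureKernelContinuousVersion (continuousKernel_of_offDiagLimitAlong)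
open Summit.QuantumFields.YangMills.Theorems.F4SubCurvatureDoorSubCurvatureKernelSoftKernel (softKernel_clauses_of_continuous_kernel)

namespace Summit.QuantumFields.YangMills.Theorems.F4SubCurvatureDoorSubCurvatureKernelSoftHalf

variable {G : Type} [Group G] [TopologicalSpace G] [IsTopologicalGroup G] [CompactSpace G]
  [MeasurableSpace G] [BorelSpace G]

/-- ★ **THE SOFT HALF OF `SubCurvatureKernel`, UNCONDITIONALLY.**  Clauses (1)(2)(3)(4)(6)(7) of the crux, verbatim, for a measurable kernel with the
sharp bound, for every off-diagonal limit point of an admissible leg scheme under `MomentBounds6`. [cite: OS1973, §2 (E2)]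
[cite: OsterwalderSeiler1978, §3] [cite: King1986, §2] [cite: GlimmJaffeQP1987, §6.2] -/
theorem softHalf_of_offDiagLimitAlong (r : LatticeRep G) {a : ℝ → ℝ} (hapos : ∀ β, 0 < a β)
    (ha0 : Tendsto a atTop (𝓝 0)) (hMB : MomentBounds6 G r a) {sch : SpeciesScheme (YMSpecies G)}
    (hsch : IsLegScheme a sch) {φ : ℕ → ℕ} (hφ : Tendsto φ atTop atTop) {S₁ : SchwingerFamily E4}
    (hS₁ : OffDiagLimitAlong r sch φ S₁) :
    ∃ K : E4 → ℝ, Measurable K ∧ (∃ A : ℝ, ∀ u : E4, u ≠ 0 → |K u| ≤ A * (1 + ‖u‖⁻¹) ^ 8) ∧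
      (∀ F : 𝓢((Fin 2 → E4), ℂ), IsOffDiagonal F →
        Integrable (fun x : Fin 2 → E4 => (K (x 0 - x 1) : ℂ) * F x) ∧ S₁ 2 F = ∫ x : Fin 2 → E4, (K (x 0 - x 1) : ℂ) * F x) ∧
      ContinuousOn K {x : E4 | x ≠ 0} ∧ (∃ C : ℝ, ∀ x : E4, 1 ≤ ‖x‖ → |K x| ≤ C) ∧
      (∀ R : E4 ≃ₗᵢ[ℝ] E4, IsSignedPerm R → ∀ x : E4, K (R x) = K x) ∧
      (∀ (m : ℕ) (x : Fin m → E4) (c : Fin m → ℝ), (∀ i, 0 < x i 0) →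
        0 ≤ ∑ i, ∑ j, c i * c j * K (timeReflection 4 (x i) - x j)) ∧
      (∀ F : 𝓢((Fin 2 → E4), ℂ), IsOffDiagonal F → HasCompactSupport (F : (Fin 2 → E4) → ℂ) →
        Integrable (fun x : Fin 2 → E4 => (K (x 0 - x 1) : ℂ) * F x) ∧ S₁ 2 F = ∫ x : Fin 2 → E4, (K (x 0 - x 1) : ℂ) * F x) ∧
      (∀ ρ : ℝ, 0 < ρ → ∀ R : E4 ≃ₗᵢ[ℝ] E4,
        (∀ F ∈ King.KingClass 2 ρ, S₁ 2 (linActMulti R F) = S₁ 2 F) ↔ (∀ x : E4, x ≠ 0 → ‖x‖ < ρ → K (R x) = K x)) := by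
  obtain ⟨K, hKm, hKc, ⟨A, hKb⟩, hrep⟩ := continuousKernel_of_offDiagLimitAlong r hapos ha0 hMB hsch hφ hS₁
  obtain ⟨h1, h2, h3, h4, h6, h7⟩ := softKernel_clauses_of_continuous_kernel r hapos ha0 hMB hsch hφ hS₁ K hKm hKc hKb hrep
  exact ⟨K, hKm, ⟨A, hKb⟩, hrep, h1, h2, h3, h4, h6, h7⟩

/-- ★ **`SubCurvatureKernel` FOLLOWS FROM ITS SUB-CURVATURE CLAUSE ALONE.**  If for every leg-scheme limit point (in the crux's prefix) and EVERY
kernel `K` continuous off `0` representing its two-point function on compactly supported off-diagonal test functions `‖x‖⁸ K x → 0` at `0`,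
then the crux `SubCurvatureKernel` holds: the soft clauses come from ✓`softHalf_of_offDiagLimitAlong`. [cite: OS1973, §2 (E2)]
[cite: King1986, §2] -/
theorem subCurvatureKernel_of_subCurvatureClause
    (hclause : ∀ (G : Type) [Group G] [TopologicalSpace G] [IsTopologicalGroup G] [CompactSpace G], IsCompactSimpleLieGroup G →
      letI : MeasurableSpace G := borel G; haveI : BorelSpace G := ⟨rfl⟩;
      ∀ (r : LatticeRep G) (a : ℝ → ℝ), (∀ β, 0 < a β) → Tendsto a atTop (nhds 0) → MomentBounds6 G r a →
        ∀ sch : SpeciesScheme (YMSpecies G), IsLegScheme a sch → ∀ φ : ℕ → ℕ, Tendsto φ atTop atTop →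
          ∀ S₁ : SchwingerFamily E4, OffDiagLimitAlong r sch φ S₁ → ∀ K : E4 → ℝ, ContinuousOn K {x : E4 | x ≠ 0} →
            (∀ F : 𝓢((Fin 2 → E4), ℂ), IsOffDiagonal F → HasCompactSupport (F : (Fin 2 → E4) → ℂ) →
              Integrable (fun x : Fin 2 → E4 => (K (x 0 - x 1) : ℂ) * F x) ∧
                S₁ 2 F = ∫ x : Fin 2 → E4, (K (x 0 - x 1) : ℂ) * F x) →
            Tendsto (fun x : E4 => ‖x‖ ^ 8 * K x) (𝓝[≠] 0) (𝓝 0)) :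
    Summit.QuantumFields.YangMills.Theses.F4SubCurvatureDoor.SubCurvatureKernel := by
  intro G _ _ _ _ hG
  letI : MeasurableSpace G := borel G
  haveI : BorelSpace G := ⟨rfl⟩
  intro r a hapos ha0 hMB sch hsch φ hφ S₁ hS₁
  obtain ⟨K, -, -, -, h1, h2, h3, h4, h6, h7⟩ := softHalf_of_offDiagLimitAlong r hapos ha0 hMB hsch hφ hS₁
  exact ⟨K, h1, h2, h3, h4, hclause G hG r a hapos ha0 hMB sch hsch φ hφ S₁ hS₁ K h1 h6, h6, h7⟩

end Summit.QuantumFields.YangMills.Theorems.F4SubCurvatureDoorSubCurvatureKernelSoftHalf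

end
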